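/-
Copyright (c) 2026 the pub-hodgecm-mathlib formalisation cell (harness21).  Prover seat hodgecm-mathlib-LH4-p12 (g2), Track A «(D-RAM) FOUR-FRAME», unit U2H_HSide, ROW (2)
child (ρ2a): the TYPE-(2) H-side dictionary in affine form — the type-(2) twin of brick (4) (dealer LH4-plan (g11) WORD #14; LH4-p06 (g2) child text 87660edafc44f803).
2026-09-04.
-/
import Summits.HodgeConjecture.HodgeConjecture.Theorems.F0P3cDyRamHProfilesTypeOneAffineWild  -- ★ p856067 (this seat): §1 place type = parity of `d`, §3 supports of the two profiles; brings ★ p855119 type-(2) unfolding, ★ `SLTwoTreeFixedSubtreeCount`, ★ anti-fixed dichotomy, ★ descent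
import Literature.NumberTheory.Rogawski1990.RankOneKappaRootStabilizerOpen                    -- ★ `exists_rootStabilizer_rhoVertexActPlace` (the root stabiliser `K ≤ U₂`, compact open, BOTH place types)
import Literature.NumberTheory.Rogawski1990.RankOneKappaOrbitalUnfoldingTree                    -- ★ `finite_fixedBy_quotient_prod_iff_fixedVertices_onePlace` (fixed cosets ↔ fixed vertices)
import Literature.NumberTheory.Automorphic.UnitaryTwoRamifiedTreeStabilizersPlace               -- ★ `rhoVertexActPlace_eq_iff_glVertexAct_eq` (any descent datum computes `ρ_w`)
import Literature.NumberTheory.Automorphic.UnitOrbitalIntegralFixedPoints                       -- ★ `finite_fixedBy_quotient_of_isClosed` (closed class + compact centraliser ⇒ finitely many fixed cosets)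
import HarnessLib

/-!
# Crux `H413`, line LH4 «(D-RAM) FOUR-FRAME», unit U2H (ii-H), ROW (2) child (ρ2a) — THE TYPE-(2) H-SIDE DICTIONARY IN AFFINE FORM:
# near `1 ∈ H_v`, for a `G`-regular `γ_H` with NO `w`-eigenvalue in `L_w`, `∃ X, ∀ s, Φ^st(γ_H, hFamily s) = ν_s·X + (if s = d mod 2 then 0 else −2ν_s)∕2`

Cell `hodgecm-mathlib` (D-0151), FLOOR 0, crux item H413 = `stmt-HodgeConjecture-24833`, route of record `HCCMUnconditional`; squad F0∕P3c∕LH4 (req620).  THEOREMS ONLY (no `def`,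
no instance, no notation, no named fact, no `sorry`, default heartbeats); lane `--supports stmt-HodgeConjecture-24833 --as helper` (count-neutral).  HEAD
**`hProfiles_typeTwo_affine_wild`** = the statement of the registered child (ρ2a) `stub_U2H_hProfiles_typeTwo_affine_wild` (U2H (ρ2′)-SPLIT edition, LH4-p06 (g2) text
87660edafc44f803) TOKEN FOR TOKEN, typed under the Lines module's scopes; consumed BY NAME by ★ p856034 `F0P3cDyRamRowTwoAtCoefStar.rowTwo_coefStar_of_hProfiles_affine_of_gSide`.

THE PROOF IS LAW-FREE (no torus datum, no census — the type-(2) «`γ_H` ↦ torus datum» dictionary is NOT needed for the affine shape).  Single stable class (type (2)), so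
`Φ^st(γ_H, hFamily s) = ν_H(C_s × U₁)·#Fix_{γ₂}(U₂ ⧸ C_s)` (★ p855119, `C₀ = K₂`, `C₁ = K♯`); on the tree of `SL₂(L⁺_v)` through ANY descent representative `g` of `E₂γ₂`
(★ (W1)), one of `K₂, K♯` counts the `g`-fixed VERTICES and the other the set-wise fixed EDGES — which is which is the place type of an anti-fixed `α₀` (unit: √u, `K₂` ↔ vertices;
uniformiser: √π, `K♯` ↔ vertices), i.e. the PARITY OF `d` (★ p856067 §1) — and on a finite fixed subtree `#edges + 1 = #vertices` (★ `SLTwoTreeFixedSubtreeCount` §3, no `|2|`,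
no torus form).  Its two hypotheses: `hx₀` (`g` fixes the root `latt 1`) holds on the WITNESS NEIGHBOURHOOD `V := K × U₁`, `K ≤ U₂` the root stabiliser (★
`exists_rootStabilizer_rhoVertexActPlace`, compact open, both place types); `hfin` (finitely many fixed vertices) from the compact centraliser of a type-(2) `γ_H` (★
`compactSpace_centralizer_endoPair_of_not_exists_isRoot_nonsplit`) and its closed class (★ `isClosed_conjClass_localH_of_isLocalGRegular`) via ★ `finite_fixedBy_quotient_of_isClosed`
and the coset ↔ vertex dictionary ★ `finite_fixedBy_quotient_prod_iff_fixedVertices_onePlace`.  Then `X := #Fix(U₂ ⧸ K_vertex)`: the vertex profile reads `ν·X + 0∕2`, the other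
`ν·(X − 1) = ν·X + (−2ν)∕2`.

* §1 `natCast_eq_sub_one_of_add_one_eq` (the `ℕ → ℂ` step), §2 HEAD `hProfiles_typeTwo_affine_wild`.

HONEST LABEL.  Count-neutral; nothing printed is asserted; `HC_CM` is proved only modulo the 7 printed citations (2 remaining named inputs: hLiu418 = `stmt-HodgeConjecture-24832`,
h413 = `stmt-HodgeConjecture-24833`) until rung 0 closes.

## References
* [Rogawski1990] J. D. Rogawski, *Automorphic Representations of Unitary Groups in Three Variables*, Ann. of Math. Stud. 123 (1990): §4.9 Prop. 4.9.1 (b) p. 55, Lemma 4.9.3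
  p. 56 (the `H`-side of the unit transfer); §3.6 pp. 28–29 (type (2): one class).
* [Kottwitz1988] R. E. Kottwitz, *Tamagawa numbers*, Ann. of Math. 127 (1988), §2 (orbital integrals of indicators as fixed-coset counts; the fixed points of an elliptic element form a
  finite subtree).
* [Serre1980Trees] J.-P. Serre, *Trees* (1980), Ch. I §6.1 (fixed points, no inversions), Ch. II §1.1–§1.3 (the tree of `SL₂`).
* [DeitmarEchterhoff2014] A. Deitmar, S. Echterhoff, *Principles of Harmonic Analysis* (2nd ed., 2014), Lemma 9.3.3 (finitely many fixed cosets for a compact-centraliser element).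
* [Jacobowitz1962] R. Jacobowitz, *Hermitian forms over local fields*, Amer. J. Math. 84 (1962), §5, §9 (ramified dyadic: parity of the different exponent).
-/

set_option autoImplicit false

noncomputable section

namespace Summit.HodgeConjecture.HodgeConjecture.Cruxes.H413.F0P3cDyRamHProfilesTypeTwoAffineWild

open MeasureTheory Measure NumberField IsDedekindDomain Topology Filter MulAction Matrix WithZero ValuativeRel
open Literature.NumberTheory.Automorphic Literature.NumberTheory.Automorphic.UnitaryGroup Literature.NumberTheory.Automorphic.IntegralReduction
open Literature.NumberTheory.Rogawski1990 Literature.NumberTheory.GaloisRepresentations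
open Literature.NumberTheory.Automorphic.UnitaryThreeFourFrame
open Literature.NumberTheory.Automorphic.HermitianLatticeTree
open Literature.NumberTheory.Automorphic.UnitaryLatticeTree Literature.NumberTheory.Automorphic.HermitianLattice
open Summit.HodgeConjecture.HodgeConjecture.Cruxes.H413.F0P3cDyRamFourFrameHSideDefs
open Summit.HodgeConjecture.HodgeConjecture.Cruxes.H413.F0P3cDyRamFourFrameHFamilyDefs
open Summit.HodgeConjecture.HodgeConjecture.Cruxes.H413.F0P3cDyRamHProfilesTypeTwoUnfolding (hFamily_zero hFamily_one stableOrbitalIntegralRel_hFamily_zero_typeTwo)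
open Summit.HodgeConjecture.HodgeConjecture.Cruxes.H413.F0P3cDyRamHProfilesTypeOneAffineWild
open scoped Matrix MatrixGroups Classical ValuativeRel WithZero

/-! ## §1 The `ℕ → ℂ` step -/

/-- `N_E + 1 = N_V` in `ℕ` gives `ν·N_E = ν·N_V + (−2ν)∕2` in `ℂ` (one fewer fixed edge than fixed vertices). [cite: Serre1980Trees, Ch. I §6.1] [cite: Kottwitz1988, §2] -/
theorem mul_natCast_eq_of_add_one_eq {NE NV : ℕ} (h : NE + 1 = NV) (ν : ℂ) : ν * (NE : ℂ) = ν * (NV : ℂ) + -2 * ν / 2 := by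
  have h' : (NE : ℂ) = (NV : ℂ) - 1 := by
    rw [← h]; push_cast; ring
  rw [h']; ring

/-! ## §2 HEAD — the (ρ2a) text, token for token -/

/-- **(ρ2a) THE TYPE-(2) H-SIDE DICTIONARY IN AFFINE FORM** — the statement of the registered child `stub_U2H_hProfiles_typeTwo_affine_wild` token for token (LH4-p06 (g2) text
87660edafc44f803): at a ramified non-split CM place `w ∣ v` with datum of record `(σ_w, ϖ, d, t_E)` there is a neighbourhood `V` of `1 ∈ H_v` (here `K × U₁`, `K ≤ U₂` the
stabiliser of the root vertex of the tree of `SL₂(L⁺_v)` through `ρ_w ∘ E₂`) such that for every `G`-regular `γ_H ∈ V` whose `w`-characteristic polynomial has NO root in `L_w`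
(type (2)) there is `X ∈ ℂ` (`= #Fix_{γ₂}(U₂ ⧸ K_vertex)`, the number of fixed vertices) with, for both profiles `s`,
`Φ^st(γ_H, hFamily s) = ν_H(supp hFamily s)·X + (if s = d mod 2 then 0 else −2·ν_H(supp hFamily s))∕2`.
LAW-FREE assembly: ★ p855119 (one class, fixed-coset counts) · ★ anti-fixed dichotomy + ★ p856067 §1 (place type = parity of `d`) · ★ (W1) descent · ★ root stabiliser (`hx₀` on `V`) ·
★ compact centraliser + closed class ⇒ finitely many fixed cosets ⇒ finitely many fixed vertices (`hfin`) · ★ `SLTwoTreeFixedSubtreeCount` §3 (`#edges + 1 = #vertices`) · ★ p856067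
§3 supports · §1.  The hypotheses `_h2`, `_hϖ`'s wildness, `tE` are not used beyond `ϖ ≠ 0` (the dictionary holds at every ramified place).
[cite: Rogawski1990, §4.9 Prop. 4.9.1 (b) p. 55, Lemma 4.9.3 p. 56; §3.6 pp. 28–29] [cite: Kottwitz1988, §2] [cite: Serre1980Trees, Ch. I §6.1; Ch. II §1.1–§1.3] [cite: DeitmarEchterhoff2014, Lemma 9.3.3] -/
theorem hProfiles_typeTwo_affine_wild :
    ∀ (L : Type) [Field L] [NumberField L] [IsCMField L]
      {v : HeightOneSpectrum (𝓞 ↥(maximalRealSubfield L))} (w : UnitaryGroup.PlacesOver L v)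
      (hw : IsCMField.complexConj L • w.1 = w.1) (_he : v.asIdeal.ramificationIdx' w.1.asIdeal ≠ 1)
      (_h2 : ¬ IsUnit (2 : 𝒪[w.1.adicCompletion L]))
      (ϖ : (w.1.adicCompletion L)) (_hϖ : Valued.v ϖ = WithZero.exp (-1 : ℤ)) (d tE : ℕ) (_hD : IsRamifiedQuadraticDatum (galAdicCompletionMap (L := L) (IsCMField.complexConj L) hw) ϖ d tE)
      [Fintype (Valued.ResidueField (w.1.adicCompletion L))]
      [MeasurableSpace ((UnitaryGroup.cmDatum L 2 (Matrix.of fun i j : Fin 2 => if i.val + j.val + 1 = 2 then (1 : L) else 0)).Local v × (UnitaryGroup.cmDatum L 1 (Matrix.of fun i j : Fin 1 => if i.val + j.val + 1 = 1 then (1 : L) else 0)).Local v)] [BorelSpace ((UnitaryGroup.cmDatum L 2 (Matrix.of fun i j : Fin 2 => if i.val + j.val + 1 = 2 then (1 : L) else 0)).Local v × (UnitaryGroup.cmDatum L 1 (Matrix.of fun i j : Fin 1 => if i.val + j.val + 1 = 1 then (1 : L) else 0)).Local v)]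
      [∀ a : ((UnitaryGroup.cmDatum L 2 (Matrix.of fun i j : Fin 2 => if i.val + j.val + 1 = 2 then (1 : L) else 0)).Local v × (UnitaryGroup.cmDatum L 1 (Matrix.of fun i j : Fin 1 => if i.val + j.val + 1 = 1 then (1 : L) else 0)).Local v), MeasurableSpace (((UnitaryGroup.cmDatum L 2 (Matrix.of fun i j : Fin 2 => if i.val + j.val + 1 = 2 then (1 : L) else 0)).Local v × (UnitaryGroup.cmDatum L 1 (Matrix.of fun i j : Fin 1 => if i.val + j.val + 1 = 1 then (1 : L) else 0)).Local v) ⧸ Subgroup.centralizer ({a} : Set ((UnitaryGroup.cmDatum L 2 (Matrix.of fun i j : Fin 2 => if i.val + j.val + 1 = 2 then (1 : L) else 0)).Local v × (UnitaryGroup.cmDatum L 1 (Matrix.of fun i j : Fin 1 => if i.val + j.val + 1 = 1 then (1 : L) else 0)).Local v)))]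
      [∀ a : ((UnitaryGroup.cmDatum L 2 (Matrix.of fun i j : Fin 2 => if i.val + j.val + 1 = 2 then (1 : L) else 0)).Local v × (UnitaryGroup.cmDatum L 1 (Matrix.of fun i j : Fin 1 => if i.val + j.val + 1 = 1 then (1 : L) else 0)).Local v), BorelSpace (((UnitaryGroup.cmDatum L 2 (Matrix.of fun i j : Fin 2 => if i.val + j.val + 1 = 2 then (1 : L) else 0)).Local v × (UnitaryGroup.cmDatum L 1 (Matrix.of fun i j : Fin 1 => if i.val + j.val + 1 = 1 then (1 : L) else 0)).Local v) ⧸ Subgroup.centralizer ({a} : Set ((UnitaryGroup.cmDatum L 2 (Matrix.of fun i j : Fin 2 => if i.val + j.val + 1 = 2 then (1 : L) else 0)).Local v × (UnitaryGroup.cmDatum L 1 (Matrix.of fun i j : Fin 1 => if i.val + j.val + 1 = 1 then (1 : L) else 0)).Local v)))]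
      (νH : Measure ((UnitaryGroup.cmDatum L 2 (Matrix.of fun i j : Fin 2 => if i.val + j.val + 1 = 2 then (1 : L) else 0)).Local v × (UnitaryGroup.cmDatum L 1 (Matrix.of fun i j : Fin 1 => if i.val + j.val + 1 = 1 then (1 : L) else 0)).Local v)) [νH.IsHaarMeasure] [νH.IsMulRightInvariant]
      (mH : OrbitalMeasureFamily ((UnitaryGroup.cmDatum L 2 (Matrix.of fun i j : Fin 2 => if i.val + j.val + 1 = 2 then (1 : L) else 0)).Local v × (UnitaryGroup.cmDatum L 1 (Matrix.of fun i j : Fin 1 => if i.val + j.val + 1 = 1 then (1 : L) else 0)).Local v))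
      (_hmH : mH.IsCanonical (IsLocalGRegular L v) νH),
      ∃ V ∈ 𝓝 (1 : ((UnitaryGroup.cmDatum L 2 (Matrix.of fun i j : Fin 2 => if i.val + j.val + 1 = 2 then (1 : L) else 0)).Local v × (UnitaryGroup.cmDatum L 1 (Matrix.of fun i j : Fin 1 => if i.val + j.val + 1 = 1 then (1 : L) else 0)).Local v)), ∀ γH ∈ V, IsLocalGRegular L v γH →
              ¬ (∃ x : (w.1.adicCompletion L), (((((γH).1.val : GL (Fin 2) (UnitaryGroup.LocalRing L v)).val.map (Pi.evalRingHom (fun w' : UnitaryGroup.PlacesOver L v => w'.1.adicCompletion L) w))).charpoly).IsRoot x) →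
              ∃ X : ℂ, ∀ s : Fin 2, stableOrbitalIntegralRel (IsLocalStablyConjH L v) mH (hFamily L w hw ϖ s) γH = (νH.real (Function.support (hFamily L w hw ϖ s)) : ℂ) * X + (if ((s : Fin 2) : ℕ) = d % 2 then (0 : ℂ) else -2 * (νH.real (Function.support (hFamily L w hw ϖ s)) : ℂ)) / 2 := by
  intro L _ _ _ v w hw he _h2 ϖ hϖ d tE hD _ _ _ _ _ νH _ _ mH hmH
  -- `ϖ ≠ 0`; make it a unit
  have hϖ0 : ϖ ≠ 0 := fun h0 => by rw [h0, map_zero] at hϖ; exact WithZero.zero_ne_coe hϖ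
  obtain ⟨ϖu, rfl⟩ : ∃ ϖu : (w.1.adicCompletion L)ˣ, (ϖu : w.1.adicCompletion L) = ϖ := ⟨Units.mk0 ϖ hϖ0, rfl⟩
  -- the F-side uniformiser and the DVR instance
  have hϖF : Valued.v (HeckeCharacter.uniformizer ↥(maximalRealSubfield L) v : v.adicCompletion ↥(maximalRealSubfield L)) = WithZero.exp (-1 : ℤ) :=
    HeckeCharacter.valued_uniformizer v
  haveI : IsDiscreteValuationRing 𝒪[v.adicCompletion ↥(maximalRealSubfield L)] := isDiscreteValuationRing_integer_of_compatible hϖF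
  -- an anti-fixed unit or uniformiser `α₀` (its type is the parity of `d`, ★ p856067 §1)
  obtain ⟨α₀, hα₀, hvα₀⟩ := exists_units_galAdicCompletionMap_complexConj_eq_neg_of_ramified L w hw he
  have hα₀0 : (α₀ : w.1.adicCompletion L) ≠ 0 := α₀.ne_zero
  -- the root vertex `x₀ = latt 1` and its stabiliser `K ≤ U₂` through `ρ_w ∘ E₂` (compact open; both place types)
  have hx₀S : IsSpecialLattice (RingHom.id (v.adicCompletion ↥(maximalRealSubfield L))) (HeckeCharacter.uniformizer ↥(maximalRealSubfield L) v : v.adicCompletion ↥(maximalRealSubfield L))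
      !![(0 : v.adicCompletion ↥(maximalRealSubfield L)), 1; -1, 0] (latt (1 : Matrix (Fin 2) (Fin 2) (v.adicCompletion ↥(maximalRealSubfield L)))) := by
    have h1 := isSpecialLattice_latt_of_valuation_det (isUniformizingElement_of_v_eq hϖF).ne_zero (1 : GL (Fin 2) (v.adicCompletion ↥(maximalRealSubfield L))) (e := 0) (Or.inl rfl)
      (by rw [Units.val_one, Matrix.det_one, zpow_zero])
    rwa [Units.val_one] at h1
  obtain ⟨K, hK, hKo, hKc⟩ := exists_rootStabilizer_rhoVertexActPlace L v w hw he hα₀ hα₀0 hvα₀ hϖF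
    (localNonsplitEquiv (IsCMField.complexConj L) (Matrix.of fun i j : Fin 2 => if i.val + j.val + 1 = 2 then (1 : L) else 0) (IsCMField.complexConj_ne_one L) w hw) (fun _ => rfl)
    ⟨latt (1 : Matrix (Fin 2) (Fin 2) (v.adicCompletion ↥(maximalRealSubfield L))), hx₀S⟩ rfl
  refine ⟨((K.prod (⊤ : Subgroup ((cmDatum L 1 (Matrix.of fun i j : Fin 1 => if i.val + j.val + 1 = 1 then (1 : L) else 0)).Local v))) :
      Subgroup ((cmDatum L 2 (Matrix.of fun i j : Fin 2 => if i.val + j.val + 1 = 2 then (1 : L) else 0)).Local v ×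
        (cmDatum L 1 (Matrix.of fun i j : Fin 1 => if i.val + j.val + 1 = 1 then (1 : L) else 0)).Local v)), hKo.mem_nhds (one_mem _), ?_⟩
  intro γH hγ hreg hirr
  -- the descent of `E₂ γ₂`
  set U := (localNonsplitEquiv (IsCMField.complexConj L) (Matrix.of fun i j : Fin 2 => if i.val + j.val + 1 = 2 then (1 : L) else 0) (IsCMField.complexConj_ne_one L) w hw) γH.1 with hUdef
  obtain ⟨s₀, g, hs, hsg⟩ := descent_of_mem_unitaryGroupOfForm_antidiag L v w hw hα₀ hα₀0 _ (coe_mem_unitaryGroupOfForm_antidiag_two_of_mem_placeForm L w hw U)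
  -- `hx₀`: on `V`, `γ₂` stabilises the root, so `g` fixes `x₀`
  have hγK : γH.1 ∈ K := (Subgroup.mem_prod.1 hγ).1
  have hx₀ : glVertexAct (isUniformizingElement_of_v_eq hϖF) g ⟨latt (1 : Matrix (Fin 2) (Fin 2) (v.adicCompletion ↥(maximalRealSubfield L))), hx₀S⟩ =
      ⟨latt (1 : Matrix (Fin 2) (Fin 2) (v.adicCompletion ↥(maximalRealSubfield L))), hx₀S⟩ :=
    (rhoVertexActPlace_eq_iff_glVertexAct_eq L v w hw hα₀ hα₀0 hϖF U hs hsg _ _).1 ((hK γH.1).1 hγK)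
  -- `hfin`: compact centraliser + closed class ⇒ finitely many fixed cosets ⇒ finitely many fixed vertices
  haveI := compactSpace_centralizer_endoPair_of_not_exists_isRoot_nonsplit L v w hw γH hirr
  have hfinQ := finite_fixedBy_quotient_of_isClosed γH _ (isClosed_conjClass_localH_of_isLocalGRegular L v γH hreg) hKo hKc
  have hfinM := (finite_fixedBy_quotient_prod_iff_fixedVertices_onePlace L v w hw hα₀ hα₀0 hϖF he K
    (localNonsplitEquiv (IsCMField.complexConj L) (Matrix.of fun i j : Fin 2 => if i.val + j.val + 1 = 2 then (1 : L) else 0) (IsCMField.complexConj_ne_one L) w hw)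
    ⟨latt (1 : Matrix (Fin 2) (Fin 2) (v.adicCompletion ↥(maximalRealSubfield L))), hx₀S⟩ rfl hK γH).1 hfinQ
  have hfin : {x : {M : Submodule 𝒪[v.adicCompletion ↥(maximalRealSubfield L)] (Fin 2 → v.adicCompletion ↥(maximalRealSubfield L)) //
      IsSpecialLattice (RingHom.id _) (HeckeCharacter.uniformizer ↥(maximalRealSubfield L) v : v.adicCompletion ↥(maximalRealSubfield L)) !![(0 : v.adicCompletion ↥(maximalRealSubfield L)), 1; -1, 0] M} |
        glVertexAct (isUniformizingElement_of_v_eq hϖF) g x = x}.Finite := by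
    refine hfinM.subset fun x hx => ?_
    exact (rhoVertexActPlace_eq_iff_glVertexAct_eq L v w hw hα₀ hα₀0 hϖF U hs hsg x x).2 hx
  -- the `K♯` level and the two unfolded counts (★ p855119, one class)
  obtain ⟨K₂, -, -, hK1mem, hKo', hKc', -⟩ := exists_vertexCover_of_ramified_wild L v w hw he ϖu hϖ
  have hΦ0 := stableOrbitalIntegralRel_hFamily_zero_typeTwo L w hw νH (ϖu : w.1.adicCompletion L) hmH hreg hirr
  have hΦ1 : stableOrbitalIntegralRel (IsLocalStablyConjH L v) mH (hFamily L w hw (ϖu : w.1.adicCompletion L) 1) γH =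
      (νH.real ((((K₂ 1).prod (⊤ : Subgroup ((cmDatum L 1 (Matrix.of fun i j : Fin 1 => if i.val + j.val + 1 = 1 then (1 : L) else 0)).Local v))) :
        Subgroup ((cmDatum L 2 (Matrix.of fun i j : Fin 2 => if i.val + j.val + 1 = 2 then (1 : L) else 0)).Local v ×
          (cmDatum L 1 (Matrix.of fun i j : Fin 1 => if i.val + j.val + 1 = 1 then (1 : L) else 0)).Local v)) :
        Set ((cmDatum L 2 (Matrix.of fun i j : Fin 2 => if i.val + j.val + 1 = 2 then (1 : L) else 0)).Local v ×
          (cmDatum L 1 (Matrix.of fun i j : Fin 1 => if i.val + j.val + 1 = 1 then (1 : L) else 0)).Local v)) : ℂ) *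
        (Nat.card (fixedBy (((cmDatum L 2 (Matrix.of fun i j : Fin 2 => if i.val + j.val + 1 = 2 then (1 : L) else 0)).Local v) ⧸ K₂ 1) γH.1) : ℂ) := by
    rw [hFamily_one]
    exact stableOrbitalIntegralRel_indicator_sharp_eq_mul_natCard_fixedBy_of_not_exists_isRoot L v w hw νH hmH ϖu (K₂ 1) hK1mem (hKo' 1) (hKc' 1) hreg hirr
  have hsupp0 := support_hFamily_zero_eq_coe_prod_top L w hw (ϖu : w.1.adicCompletion L)
  have hsupp1 := support_hFamily_one_eq_coe_prod_top L w hw ϖu (K₂ 1) hK1mem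
  -- by place type (= parity of `d`)
  rcases hvα₀ with hvα₀ | hvα₀
  · -- √u-type place: `d` even; `K₂` ↔ vertices, `K♯` ↔ edges: `#Fix(U₂⧸K♯) + 1 = #Fix(U₂⧸K₂)`
    have hd2 : d % 2 = 0 := mod_two_eq_zero_of_antiFixed_of_v_eq_one hD hα₀ hvα₀
    have hrel := natCard_fixedBy_modular_add_one_eq_natCard_fixedBy_cmLocalIntegralLevel_of_v_eq_one L v w hw hα₀ hα₀0 hϖF he hvα₀ ϖu hϖ (K₂ 1) hK1mem γH.1 hs hsg hx₀ hfin
    refine ⟨(Nat.card (fixedBy (((cmDatum L 2 (Matrix.of fun i j : Fin 2 => if i.val + j.val + 1 = 2 then (1 : L) else 0)).Local v) ⧸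
      cmLocalIntegralLevel L 2 (Matrix.of fun i j : Fin 2 => if i.val + j.val + 1 = 2 then (1 : L) else 0) v) γH.1) : ℂ), fun s => ?_⟩
    fin_cases s
    · simp only [Fin.zero_eta, Fin.isValue]
      rw [hΦ0, hsupp0, if_pos hd2.symm, zero_div, add_zero]
    · simp only [Fin.mk_one, Fin.isValue]
      rw [hΦ1, hsupp1, if_neg (show (1 : ℕ) ≠ d % 2 by omega)]
      exact mul_natCast_eq_of_add_one_eq hrel _
  · -- √π-type place: `d` odd; `K₂` ↔ edges, `K♯` ↔ vertices: `#Fix(U₂⧸K₂) + 1 = #Fix(U₂⧸K♯)`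
    have hd2 : d % 2 = 1 := mod_two_eq_one_of_antiFixed_of_v_eq_exp_neg_one hD hα₀ hvα₀
    have hrel := natCard_fixedBy_cmLocalIntegralLevel_add_one_eq_natCard_fixedBy_modular_of_v_eq_exp_neg_one L v w hw hα₀ hα₀0 hϖF he hvα₀ ϖu hϖ (K₂ 1) hK1mem γH.1 hs hsg hx₀ hfin
    refine ⟨(Nat.card (fixedBy (((cmDatum L 2 (Matrix.of fun i j : Fin 2 => if i.val + j.val + 1 = 2 then (1 : L) else 0)).Local v) ⧸ K₂ 1) γH.1) : ℂ), fun s => ?_⟩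
    fin_cases s
    · simp only [Fin.zero_eta, Fin.isValue]
      rw [hΦ0, hsupp0, if_neg (show (0 : ℕ) ≠ d % 2 by omega)]
      exact mul_natCast_eq_of_add_one_eq hrel _
    · simp only [Fin.mk_one, Fin.isValue]
      rw [hΦ1, hsupp1, if_pos hd2.symm, zero_div, add_zero]

end Summit.HodgeConjecture.HodgeConjecture.Cruxes.H413.F0P3cDyRamHProfilesTypeTwoAffineWild

end
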